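import Summits.CriticalPhenomena.CardyFormulaZ2.Theorems.CardyComplexConeDefs
import Literature.Probability.LatticeModels.LatticeDobrushinBox
import Literature.Probability.Percolation.QuadCrossingSquareModel

/-!
# The three-sided box is the carrier of a Jordan Dobrushin domain; depth of its lattice points
(line `qkz-strip-boundary-arm` of crux `CardyComplexCone.EdgePrecompact`, stmt-CriticalPhenomena-11387;
necessity certificate "UniformInnerEnvelope ⇒ cube-root upper bound for the half-plane one-arm
probability of bond-ℤ²", piece N1: registered sub-goals `exists_dobrushinDomain_threeSided` and
`threeSided_infDist_compl`)

The three-sided box `LatticeDobrushin.threeSided W H` (sites `[0, W] × [-1, H]`, tree file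
`Literature/Probability/LatticeModels/LatticeDobrushinBox.lean`) is realised at mesh `1` by the
continuum datum `(threeSided W H).toDobrushin` whose domain is the site-square domain
`siteDomain S` of its sites. This file proves:

* `siteDomain_threeSided_eq_rect_N1`: that domain is the open rectangle
  `(-1/2, W + 1/2) × (-3/2, H + 1/2)` (two rounding test points; the generic box version is
  `siteDomain_boxSites` of `Summits/CriticalPhenomena/SAWScalingLimit/Theorems/BoundaryTP2Negative_BoxDomain.lean`,
  re-proved here for the three-sided box to keep the dependency cone inside this problem);
* `exists_dobrushinDomain_threeSided`: hence it is the carrier of a Jordan Dobrushin domain — the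
  axis-parallel rectangle `rectQuad` of `Literature/Probability/Percolation/QuadCrossingSquareModel.lean`
  with two of its four marked corners kept (`MarkedDomain.chord 0 2`);
* `threeSided_infDist_compl`: the lattice point `(x, y)` of the box lies at distance at least
  `min (x + 1/2, W + 1/2 - x, y + 3/2, H + 1/2 - y)` from the complement of the domain (every point
  closer than that to `(x, y)` has real and imaginary parts inside the rectangle, since coordinate
  differences are bounded by the distance).

Elementary; no named fact is used.
-/

namespace Summit.CriticalPhenomena.CardyFormulaZ2.Cruxes.EdgePrecompact.QkzStripBoundaryArm

open MeasureTheory Filter Set Metric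
open scoped Topology BigOperators Pointwise
open Literature.Probability.LatticeModels Literature.Probability.Percolation
open Literature.Probability.RandomPlanarGeometry (DobrushinDomain)
open Summit.CriticalPhenomena.CardyFormulaZ2.Theses.CardyComplexCone

noncomputable section

/-! ## The site-square domain of the three-sided box is an open rectangle -/

-- The two rounding lemmas and the rectangle lemma are adapted from `siteDomain_boxSites`
-- (Summits/CriticalPhenomena/SAWScalingLimit/Theorems/BoundaryTP2Negative_BoxDomain.lean).

/-- Rounding up: every point `z` of the plane is sup-close (`‖z - v‖_∞ ≤ 1/2`) to the lattice point
`v = (⌈re z - 1/2⌉, ⌈im z - 1/2⌉)`, the sup-close lattice point with the smallest coordinates. -/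
private theorem supClose_ceil_N1 (z : ℂ) : SupClose z ![⌈z.re - 1 / 2⌉, ⌈z.im - 1 / 2⌉] := by
  refine Fin.forall_fin_two.2 ⟨?_, ?_⟩
  · simp only [coordC_zero, Matrix.cons_val_zero]
    rw [abs_le]
    constructor
    · have := Int.ceil_lt_add_one (z.re - 1 / 2); linarith
    · have := Int.le_ceil (z.re - 1 / 2); linarith
  · simp only [coordC_one, Matrix.cons_val_one, Matrix.cons_val_zero]
    rw [abs_le]
    constructor
    · have := Int.ceil_lt_add_one (z.im - 1 / 2); linarith
    · have := Int.le_ceil (z.im - 1 / 2); linarith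

/-- Rounding down: every point `z` of the plane is sup-close (`‖z - v‖_∞ ≤ 1/2`) to the lattice
point `v = (⌊re z + 1/2⌋, ⌊im z + 1/2⌋)`, the sup-close lattice point with the largest coordinates. -/
private theorem supClose_floor_N1 (z : ℂ) : SupClose z ![⌊z.re + 1 / 2⌋, ⌊z.im + 1 / 2⌋] := by
  refine Fin.forall_fin_two.2 ⟨?_, ?_⟩
  · simp only [coordC_zero, Matrix.cons_val_zero]
    rw [abs_le]
    constructor
    · have := Int.floor_le (z.re + 1 / 2); linarith
    · have := Int.lt_floor_add_one (z.re + 1 / 2); linarith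
  · simp only [coordC_one, Matrix.cons_val_one, Matrix.cons_val_zero]
    rw [abs_le]
    constructor
    · have := Int.floor_le (z.im + 1 / 2); linarith
    · have := Int.lt_floor_add_one (z.im + 1 / 2); linarith

/-- **The domain of the three-sided box is an open rectangle**: the site-square domain of the
sites `[0, W] × [-1, H]` of `LatticeDobrushin.threeSided W H` (the points of the plane all of whose
sup-close lattice points are sites) is the open rectangle `(-1/2, W + 1/2) × (-3/2, H + 1/2)`. -/
theorem siteDomain_threeSided_eq_rect_N1 (W H : ℕ) :
    siteDomain (LatticeDobrushin.threeSided W H).S =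
      Ioo (-(1 / 2) : ℝ) ((W : ℝ) + 1 / 2) ×ℂ Ioo (-(3 / 2) : ℝ) ((H : ℝ) + 1 / 2) := by
  ext z
  rw [mem_siteDomain_iff, Complex.mem_reProdIm, mem_Ioo, mem_Ioo]
  constructor
  · intro h
    -- two test points: the ceiling point bounds `z` from below, the floor point from above
    have hlo := h _ (supClose_ceil_N1 z)
    have hhi := h _ (supClose_floor_N1 z)
    rw [LatticeDobrushin.mem_threeSided_S] at hlo hhi
    simp only [Matrix.cons_val_zero, Matrix.cons_val_one] at hlo hhi
    obtain ⟨h0, -, h1, -⟩ := hlo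
    obtain ⟨-, h2, -, h3⟩ := hhi
    refine ⟨⟨?_, ?_⟩, ?_, ?_⟩
    · have hc : ((0 : ℤ) : ℝ) ≤ (⌈z.re - 1 / 2⌉ : ℝ) := by exact_mod_cast h0
      have := Int.ceil_lt_add_one (z.re - 1 / 2)
      push_cast at hc
      linarith
    · have hc : ((⌊z.re + 1 / 2⌋ : ℤ) : ℝ) ≤ ((W : ℤ) : ℝ) := by exact_mod_cast h2
      have := Int.lt_floor_add_one (z.re + 1 / 2)
      push_cast at hc
      linarith
    · have hc : ((-1 : ℤ) : ℝ) ≤ (⌈z.im - 1 / 2⌉ : ℝ) := by exact_mod_cast h1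
      have := Int.ceil_lt_add_one (z.im - 1 / 2)
      push_cast at hc
      linarith
    · have hc : ((⌊z.im + 1 / 2⌋ : ℤ) : ℝ) ≤ ((H : ℤ) : ℝ) := by exact_mod_cast h3
      have := Int.lt_floor_add_one (z.im + 1 / 2)
      push_cast at hc
      linarith
  · rintro ⟨⟨hr1, hr2⟩, hi1, hi2⟩ x hx
    have hx0 := hx 0
    have hx1 := hx 1
    simp only [coordC_zero, coordC_one] at hx0 hx1
    rw [abs_le] at hx0 hx1
    rw [LatticeDobrushin.mem_threeSided_S]
    refine ⟨?_, ?_, ?_, ?_⟩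
    · have h' : ((-1 : ℤ) : ℝ) < (x 0 : ℝ) := by push_cast; linarith [hx0.1, hx0.2]
      have h'' : (-1 : ℤ) < x 0 := by exact_mod_cast h'
      omega
    · have h' : (x 0 : ℝ) < ((W : ℤ) : ℝ) + 1 := by push_cast; linarith [hx0.1, hx0.2]
      have h'' : x 0 < (W : ℤ) + 1 := by exact_mod_cast h'
      omega
    · have h' : ((-2 : ℤ) : ℝ) < (x 1 : ℝ) := by push_cast; linarith [hx1.1, hx1.2]
      have h'' : (-2 : ℤ) < x 1 := by exact_mod_cast h'
      omega
    · have h' : (x 1 : ℝ) < ((H : ℤ) : ℝ) + 1 := by push_cast; linarith [hx1.1, hx1.2]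
      have h'' : x 1 < (H : ℤ) + 1 := by exact_mod_cast h'
      omega

/-! ## The three-sided box as a Jordan Dobrushin domain -/

/-- **The three-sided box is the carrier of a Jordan Dobrushin domain** (registered sub-goal
`exists_dobrushinDomain_threeSided` of the necessity certificate): for all `W H : ℕ` there is a
Dobrushin domain `D` (a Jordan domain with two marked boundary points) whose carrier is the domain
`(threeSided W H).toDobrushin.Ω = siteDomain S` of the realisation of the three-sided box at mesh `1`;
namely the axis-parallel rectangle `(-1/2, W + 1/2) × (-3/2, H + 1/2)` (`rectQuad`, boundary loop the
polygon through its corners) with its bottom-left and top-right corners kept as the two marks. -/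
theorem exists_dobrushinDomain_threeSided :
    ∀ W H : ℕ, ∃ D : DobrushinDomain, D.carrier = (LatticeDobrushin.threeSided W H).toDobrushin.Ω := by
  intro W H
  have hx : (-(1 / 2) : ℝ) < (W : ℝ) + 1 / 2 := by linarith [(Nat.cast_nonneg W : (0 : ℝ) ≤ W)]
  have hy : (-(3 / 2) : ℝ) < (H : ℝ) + 1 / 2 := by linarith [(Nat.cast_nonneg H : (0 : ℝ) ≤ H)]
  refine ⟨(rectQuad _ _ _ _ hx hy).chord 0 2 (by decide), ?_⟩
  rw [Literature.Probability.RandomPlanarGeometry.MarkedDomain.carrier_chord, rectQuad_carrier,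
    LatticeDobrushin.toDobrushin_Ω, siteDomain_threeSided_eq_rect_N1]

/-! ## Depth of the lattice points of the three-sided box -/

/-- **Depth of the lattice points of the three-sided box** (registered sub-goal
`threeSided_infDist_compl` of the necessity certificate): the lattice point `(x, y)`,
`0 ≤ x ≤ W`, `-1 ≤ y ≤ H`, of the three-sided box lies at distance at least
`min (min (x + 1/2) (W + 1/2 - x)) (min (y + 3/2) (H + 1/2 - y))` from the complement of the domain
`(threeSided W H).toDobrushin.Ω` (the open rectangle `(-1/2, W + 1/2) × (-3/2, H + 1/2)`): a point `w`
closer than that to `(x, y)` has `|re w - x|, |im w - y|` smaller than the respective margins, so lies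
in the rectangle. (The hypotheses on `x, y` are those of the registered statement; the bound holds, and
is proved, without them.) -/
theorem threeSided_infDist_compl :
    ∀ (W H : ℕ) (x y : ℤ), 0 ≤ x → x ≤ W → -1 ≤ y → y ≤ H →
      min (min ((x : ℝ) + 1 / 2) ((W : ℝ) + 1 / 2 - x)) (min ((y : ℝ) + 3 / 2) ((H : ℝ) + 1 / 2 - y)) ≤
        infDist (meshPoint 1 ![x, y]) ((LatticeDobrushin.threeSided W H).toDobrushin.Ω)ᶜ := by
  intro W H x y _ _ _ _
  rw [LatticeDobrushin.toDobrushin_Ω, siteDomain_threeSided_eq_rect_N1, meshPoint_one]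
  have hne : (Ioo (-(1 / 2) : ℝ) ((W : ℝ) + 1 / 2) ×ℂ Ioo (-(3 / 2) : ℝ) ((H : ℝ) + 1 / 2))ᶜ.Nonempty := by
    refine ⟨-1, fun h => ?_⟩
    have h' := ((Complex.mem_reProdIm).1 h).1.1
    norm_num at h'
  refine (Metric.le_infDist hne).2 fun w hw => ?_
  by_contra hlt
  rw [not_le, lt_min_iff, lt_min_iff, lt_min_iff] at hlt
  obtain ⟨⟨h1, h2⟩, h3, h4⟩ := hlt
  have hre := abs_le.1 (Complex.abs_re_le_norm (Site.toComplex ![x, y] - w))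
  have him := abs_le.1 (Complex.abs_im_le_norm (Site.toComplex ![x, y] - w))
  rw [← Complex.dist_eq] at hre him
  simp only [Complex.sub_re, Complex.sub_im, Site.toComplex_re, Site.toComplex_im,
    Matrix.cons_val_zero, Matrix.cons_val_one] at hre him
  apply hw
  rw [Complex.mem_reProdIm, mem_Ioo, mem_Ioo]
  refine ⟨⟨?_, ?_⟩, ?_, ?_⟩ <;> linarith [hre.1, hre.2, him.1, him.2]

end

end Summit.CriticalPhenomena.CardyFormulaZ2.Cruxes.EdgePrecompact.QkzStripBoundaryArm
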